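import Summits.QuantumFields.BalabanUV.T4Continuum.Support.NE7K1LinHomGramUpper
import Summits.QuantumFields.BalabanUV.T4Continuum.Support.NE7K1LinHomKerSpec
import Summits.QuantumFields.BalabanUV.T4Continuum.Support.NE7K1LinHomTensor

/-!
# NE7K1LinHomSpecUpper — row NE7 (node U5), candidate route HOM, path H1L, cell K1-lin(s): THE L-UNIFORM UPPER TWO-RUN COMPARISON
# ON BOXES WITH THE SPECTRAL CONSTANT — `⟨V, P_B^{Schur}V⟩ ≤ 3·(6∕5)^d·⟨V, P_A V⟩` (= 3, 3.6, 4.32, 5.184 for `d+1 = 1…4`)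

Lineage `b2b-balaban-t4-ne7-p2` (CRUX PROVER NE7 #2), generation 67 (third file; g66's OPEN item (4)(ii) «transverse factors by
the Gram matrix's ℓ²-NORM»).  `NE7K1LinHomGramUpper.schurB_form_le_gram` charged each transverse factor of the tensor lift its Gram
ROW SUM `(37∕30)·L`; here each factor is charged its OPERATOR NORM: `(6∕5)·L` per transverse direction
(`NE7K1LinHomKerSpec.kerF_sq_sum_le`) and `3∕L` for the bond factor, multiplied by the tensor lemma
`NE7K1LinHomTensor.sq_sum_prod_kernel_le` (no Schur test on the product Gram matrix, which cannot see the sign of `B = Σℓ_jr_j < 0`).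
Both one-dimensional constants are the `L → ∞` limits of the true norms of THIS lift's factors, so `3·(6∕5)^d` is the lift's own
asymptotic constant; lens 2's sharp floors for the optimal lift are `3 ∕ 3.556769 ∕ 4.131856 ∕ 4.720730` (t4-ne7-idea-2, THEOREM K;
corner ∕ checkerboard modes).  All [folklore]:

* §1 one-dimensional wrappers on `Ico 0 N ⊂ ℤ`: `kerF_sq_sum_le_Ico` (`6∕5·L`), `bondF_sq_sum_le_Ico` (`3∕L`, from
  `NE7K1LinHomGramBond.gramB_row_abs` by the Schur test — in one dimension the bond factor's row sum IS already `3 − 6∕L² + 4∕L³`).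
* §2 **`energy_dir_le_spec`**: `L²·Σ_{fine ν-bonds}(Φ(x+e_ν) − Φ x)² ≤ 3·(6∕5)^d·L^{d+1}·Σ_{coarse ν-bonds}(V(Y) − V(Y+e_ν))²`.
* §3 the assembly made GENERIC in the constant: **`schurB_form_le_of_energy`** (any directional energy constant `C ≥ 1` gives
  `⟨V,P_B^{Schur}V⟩ ≤ C·⟨V,P_A V⟩` on boxes) and **`twoCutoff_inv_lipschitz_of_le`** (any two-run upper constant `C ≥ 1` gives the
  ∂_s letter `(C − 1)∕min(2,a)`, `C > 1`), so that later sharpenings only re-prove §2.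
* §4 **`schurB_form_le_spec`**: `⟨V, twoCutoffLine … 1 V⟩ ≤ 3·(6∕5)^d·⟨V, runA V⟩` on boxes `R′ = Π_μ[0, nLM_μ)`, every `L`; with
  `NE7K1LinTwoRunJensen.runA_form_le_schurB_sharp`: **`P_A ⪯ P_B^{Schur} ⪯ 3·(6∕5)^d·P_A`, uniformly in `L`**; and
  **`twoCutoff_inv_lipschitz_spec`**: `‖(G(s) − G(t))g‖² ≤ (t−s)²((3·(6∕5)^d − 1)∕min(2,a))²‖g‖²`.

HONEST FRAMING: Gaussian `A = 0`, finite boxes, finite real matrices, [folklore]; ONE RG step in `U = 1` gauge; a census ∕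
NEEDS-CONSTANT sharpening (`3·(37∕30)^d ↦ 3·(6∕5)^d`: 3.70 ↦ 3.6, 4.56 ↦ 4.32, 5.63 ↦ 5.184 for `d+1 = 2, 3, 4`), no letter ∕ tag ∕
size of NE7 moves; nothing printed asserted; no `sorry`.  FIXED FINITE T⁴, rung (B)+1; NE7 NOT PRINTED ∕ NOT PROVED; spine 0∕9; NOT
infinite volume, NOT mass gap, NOT Clay.  HONEST DEPENDENCY: continuum YM on T⁴ ⇐ BetaPertH ∧ nine spine estimates (0/9 proved);
BetaPertH ⇐ (D1) ∧ (D4) ∧ CAP+tail; G-an2-4 gates asym, D1 and NE2/3/4.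
-/

noncomputable section

open Finset Matrix

namespace Summit.QuantumFields.BalabanUV.T4Continuum.NE7K1LinHomSpecUpper

open Literature.MathematicalPhysics.QuantumFieldTheory.Balaban1983to89
open Literature.MathematicalPhysics.QuantumFieldTheory.Balaban1983to89.B4Reflection242
open Literature.MathematicalPhysics.QuantumFieldTheory.Balaban1983to89.B4BoxCov237
open Literature.MathematicalPhysics.QuantumFieldTheory.Balaban1983to89.B4Lower18
open Literature.MathematicalPhysics.QuantumFieldTheory.Balaban1983to89.B4Green244 (finePt)
open NE7K1LinHomKernel NE7K1LinHomKernelSums NE7K1LinHomKernelBond NE7K1LinHomLift NE7K1LinHomUpper NE7K1LinHomGramSums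
  NE7K1LinHomGramKernel NE7K1LinHomGramBond NE7K1LinHomGramUpper NE7K1LinHomKerSpec NE7K1LinHomTensor

variable {d : ℕ}

/-! ### §1 One-dimensional wrappers on `Ico 0 N ⊂ ℤ` -/

section OneDim

variable {N L : ℕ}

/-- the spectral bound of the interpolation kernel, `Ico` form: `Σ_{t ∈ [0,NL)} (Σ_{y ∈ [0,N)} k̃(t,y)h_y)² ≤ (6∕5)·L·Σ_{y∈[0,N)} h_y²`.
[folklore] -/
theorem kerF_sq_sum_le_Ico (hL : 1 ≤ L) (N : ℕ) (h : ℤ → ℝ) :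
    ∑ t ∈ Finset.Ico (0 : ℤ) (N * L : ℕ), (∑ y ∈ Finset.Ico (0 : ℤ) N, kerF N L t y * h y) ^ 2 ≤
      6 / 5 * (L : ℝ) * ∑ y ∈ Finset.Ico (0 : ℤ) N, h y ^ 2 := by
  have e : ∀ t : ℤ, ∑ y ∈ Finset.Ico (0 : ℤ) N, kerF N L t y * h y = ∑ y ∈ range N, kerF N L t y * h y :=
    fun t => NE7K1LinHomLift.sum_Ico_eq_sum_range (fun y => kerF N L t y * h y) N
  simp_rw [e]
  rw [NE7K1LinHomLift.sum_Ico_eq_sum_range (fun t => (∑ y ∈ range N, kerF N L t y * h y) ^ 2) (N * L),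
    NE7K1LinHomLift.sum_Ico_eq_sum_range (fun y => h y ^ 2) N]
  exact kerF_sq_sum_le hL h

/-- the bond kernel's squared sums, `Ico` form: `Σ_{t ∈ [0,NL−1)} (Σ_{y ∈ [0,N)} b(t,y)h_y)² ≤ (3∕L)·Σ_{y∈[0,N)} h_y²` — by the
Schur test on the bond Gram matrix (`gramB_row_abs`: `L·Σ_Z|Gb(Y,Z)| ≤ 3`). [folklore] -/
theorem bondF_sq_sum_le_Ico (hL : 1 ≤ L) (N : ℕ) (h : ℤ → ℝ) :
    ∑ t ∈ Finset.Ico (0 : ℤ) ((N * L : ℕ) - 1), (∑ y ∈ Finset.Ico (0 : ℤ) N, bondF N L t y * h y) ^ 2 ≤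
      3 / (L : ℝ) * ∑ y ∈ Finset.Ico (0 : ℤ) N, h y ^ 2 := by
  have hLr : (0 : ℝ) < L := by exact_mod_cast hL
  have hexp : ∑ t ∈ Finset.Ico (0 : ℤ) ((N * L : ℕ) - 1), (∑ y ∈ Finset.Ico (0 : ℤ) N, bondF N L t y * h y) ^ 2 =
      ∑ y ∈ Finset.Ico (0 : ℤ) N, ∑ z ∈ Finset.Ico (0 : ℤ) N, h y * h z * gramB N L y z := by
    have e : ∀ t ∈ Finset.Ico (0 : ℤ) ((N * L : ℕ) - 1), (∑ y ∈ Finset.Ico (0 : ℤ) N, bondF N L t y * h y) ^ 2 =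
        ∑ y ∈ Finset.Ico (0 : ℤ) N, ∑ z ∈ Finset.Ico (0 : ℤ) N, h y * h z * (bondF N L t y * bondF N L t z) := by
      intro t _
      rw [sq, Finset.sum_mul_sum]
      exact Finset.sum_congr rfl fun y _ => Finset.sum_congr rfl fun z _ => by ring
    rw [Finset.sum_congr rfl e, Finset.sum_comm]
    refine Finset.sum_congr rfl fun y _ => ?_
    rw [Finset.sum_comm]
    refine Finset.sum_congr rfl fun z _ => ?_
    rw [← Finset.mul_sum, gramB_eq_Ico]
  rw [hexp]
  have hrow : ∀ y ∈ Finset.Ico (0 : ℤ) N, ∑ z ∈ Finset.Ico (0 : ℤ) N, |gramB N L y z| ≤ 3 / (L : ℝ) := by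
    intro y hy
    rw [Finset.mem_Ico] at hy
    rw [le_div_iff₀ hLr, mul_comm, NE7K1LinHomLift.sum_Ico_eq_sum_range (fun z => |gramB N L y z|) N]
    exact gramB_row_abs hL hy.1 hy.2
  exact sum_mul_mul_le_of_symm (Finset.Ico (0 : ℤ) N) h (gramB N L) gramB_comm hrow

end OneDim

/-! ### §2 The directional energy bound with the spectral constant -/

section Energy

variable {N : Fin (d + 1) → ℕ} {L : ℕ}

/-- **THE DIRECTIONAL ENERGY BOUND, SPECTRAL FORM**: `L²·Σ_{fine ν-bonds}(Φ(x+e_ν) − Φ x)² ≤ 3·(6∕5)^d·L^{d+1}·Σ_{coarse ν-bonds}(ΔV)²`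
— each transverse factor of the tensor lift enters through its ℓ²-norm `(6∕5)·L` (`kerF_sq_sum_le`), the bond factor through
`3∕L`, multiplied by the tensor lemma; g66's Gram row-sum form had `3·(37∕30)^d`. [folklore] -/
theorem energy_dir_le_spec (hL : 1 ≤ L) (ν : Fin (d + 1)) (V : (Fin (d + 1) → ℤ) → ℝ) :
    (L : ℝ) ^ 2 * ∑ x ∈ (fineBox N L).filter (fun x => x + uvec ν ∈ fineBox N L),
        (lift N L V (x + uvec ν) - lift N L V x) ^ 2 ≤
      3 * (6 / 5 : ℝ) ^ d * (L : ℝ) ^ (d + 1) *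
        ∑ Y ∈ (boxDom N).filter (fun Y => Y + uvec ν ∈ boxDom N), (V Y - V (Y + uvec ν)) ^ 2 := by
  classical
  have hLr : (0 : ℝ) < L := by exact_mod_cast hL
  set F := (fineBox N L).filter (fun x => x + uvec ν ∈ fineBox N L) with hF
  set S := (boxDom N).filter (fun Y => Y + uvec ν ∈ boxDom N) with hS
  -- the truncated coarse gradient, extended by zero to the whole coarse box
  set g : (Fin (d + 1) → ℤ) → ℝ := fun Y => if Y + uvec ν ∈ boxDom N then V Y - V (Y + uvec ν) else 0 with hg
  -- Abel-summed increment, with the sum extended to the whole box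
  have hexp : ∀ x ∈ F, (lift N L V (x + uvec ν) - lift N L V x) ^ 2 =
      (∑ Y ∈ boxDom N, g Y * ∏ μ, (fun μ t y => if μ = ν then bondF (N μ) L t y else kerF (N μ) L t y) μ (x μ) (Y μ)) ^ 2 := by
    intro x hx
    rw [hF, Finset.mem_filter] at hx
    have hx0 : 0 ≤ x ν := ((mem_boxDom.1 hx.1) ν).1
    have hx1 : x ν + 1 < N ν * L := by
      have := (add_uvec_mem_boxDom ν hx.1).1 hx.2; push_cast at this; exact this
    rw [lift_succ_sub ν V hx0 hx1, Finset.sum_filter]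
    congr 1
    refine Finset.sum_congr rfl fun Y _ => ?_
    rw [hg]
    simp only
    split_ifs with h
    · rfl
    · rw [zero_mul]
  have hsq : ∑ Y ∈ boxDom N, g Y ^ 2 = ∑ Y ∈ S, (V Y - V (Y + uvec ν)) ^ 2 := by
    rw [hS, Finset.sum_filter]
    refine Finset.sum_congr rfl fun Y _ => ?_
    rw [hg]
    simp only
    split_ifs with h
    · rfl
    · simp
  -- the tensor lemma with the one-dimensional ℓ² constants
  have hc : ∀ μ : Fin (d + 1), 0 ≤ (fun μ => if μ = ν then 3 / (L : ℝ) else 6 / 5 * (L : ℝ)) μ := fun μ => by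
    simp only
    split_ifs <;> positivity
  have hker : ∀ (μ : Fin (d + 1)) (h : ℤ → ℝ),
      ∑ t ∈ (fun μ => if μ = ν then Finset.Ico (0 : ℤ) ((N μ * L : ℕ) - 1) else Finset.Ico (0 : ℤ) (N μ * L : ℕ)) μ,
        (∑ y ∈ (fun μ => Finset.Ico (0 : ℤ) (N μ)) μ,
          (fun μ t y => if μ = ν then bondF (N μ) L t y else kerF (N μ) L t y) μ t y * h y) ^ 2 ≤
        (fun μ => if μ = ν then 3 / (L : ℝ) else 6 / 5 * (L : ℝ)) μ * ∑ y ∈ (fun μ => Finset.Ico (0 : ℤ) (N μ)) μ, h y ^ 2 := by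
    intro μ h
    simp only
    by_cases hμ : μ = ν
    · simp only [hμ, if_true]
      exact bondF_sq_sum_le_Ico hL (N ν) h
    · simp only [hμ, if_false]
      exact kerF_sq_sum_le_Ico hL (N μ) h
  have hmain := sq_sum_prod_kernel_le (d + 1) (fun μ => Finset.Ico (0 : ℤ) (N μ))
    (fun μ => if μ = ν then Finset.Ico (0 : ℤ) ((N μ * L : ℕ) - 1) else Finset.Ico (0 : ℤ) (N μ * L : ℕ))
    (fun μ t y => if μ = ν then bondF (N μ) L t y else kerF (N μ) L t y)
    (fun μ => if μ = ν then 3 / (L : ℝ) else 6 / 5 * (L : ℝ)) hc hker g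
  rw [prod_ite_eq_mul_pow ν, ← filter_fineBox_eq ν, ← hF] at hmain
  change ∑ x ∈ F, (∑ Y ∈ boxDom N, g Y * ∏ μ, (fun μ t y => if μ = ν then bondF (N μ) L t y else kerF (N μ) L t y) μ (x μ) (Y μ)) ^ 2
    ≤ 3 / (L : ℝ) * (6 / 5 * (L : ℝ)) ^ d * ∑ Y ∈ boxDom N, g Y ^ 2 at hmain
  rw [← Finset.sum_congr rfl hexp, hsq] at hmain
  calc (L : ℝ) ^ 2 * ∑ x ∈ F, (lift N L V (x + uvec ν) - lift N L V x) ^ 2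
      ≤ (L : ℝ) ^ 2 * (3 / (L : ℝ) * (6 / 5 * (L : ℝ)) ^ d * ∑ Y ∈ S, (V Y - V (Y + uvec ν)) ^ 2) :=
        mul_le_mul_of_nonneg_left hmain (by positivity)
    _ = 3 * (6 / 5 : ℝ) ^ d * (L : ℝ) ^ (d + 1) * ∑ Y ∈ S, (V Y - V (Y + uvec ν)) ^ 2 := by
        rw [mul_pow, pow_succ]; field_simp; ring

end Energy

/-! ### §3 The assembly, generic in the constant -/

section Generic

open NE7K1LinTwoRunFaces NE7K1LinSchurLineU1 NE7K1LinHomTrial NE7K1LinSchurLineForm NE7K1LinBlockCoords NE7K1LinTwoRunKit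
  NE7K1LinTwoRunUpper NE7K1LinTwoRunLower NE7K1LinSchurLineDerivRel NE7K1LinSchurLineDerivU1 NE7K1LinTwoRunJensen
  NE7K1LinInvAntitone NE7K1LinTwoRunMonotone

variable {n L : ℕ} [NeZero L]

/-- **THE UPPER TWO-RUN COMPARISON ON BOXES FROM ANY DIRECTIONAL ENERGY CONSTANT**: if the homogenised lift satisfies
`L²·E_fine,ν(Φ) ≤ C·L^{d+1}·E_coarse,ν(V)` for every direction `ν` and every coarse `V` (`C ≥ 1`), then
`⟨V, P_B^{Schur}V⟩ ≤ C·⟨V, P_A V⟩` on `R′ = Π_μ[0, nLM_μ)` (the route of `NE7K1LinHomGramUpper.schurB_form_le_gram`, made generic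
in `C`). [folklore] -/
theorem schurB_form_le_of_energy (hn : 1 ≤ n) (M : Fin (d + 1) → ℕ) {R' : Finset (Fin (d + 1) → ℤ)}
    (hbox : R' = boxDom fun μ => n * L * M μ) (hR' : IsBlockUnion (n * L) R') {a : ℝ} (ha : 0 < a) {C : ℝ} (hC : 1 ≤ C)
    (hE : ∀ (ν : Fin (d + 1)) (V' : (Fin (d + 1) → ℤ) → ℝ),
      (L : ℝ) ^ 2 * ∑ x ∈ (fineBox (fun μ => n * M μ) L).filter (fun x => x + uvec ν ∈ fineBox (fun μ => n * M μ) L),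
          (lift (fun μ => n * M μ) L V' (x + uvec ν) - lift (fun μ => n * M μ) L V' x) ^ 2 ≤
        C * (L : ℝ) ^ (d + 1) * ∑ Y ∈ (boxDom fun μ => n * M μ).filter (fun Y => Y + uvec ν ∈ boxDom fun μ => n * M μ),
          (V' Y - V' (Y + uvec ν)) ^ 2)
    (V : ↥(R'.image (blk L)) → ℝ) :
    V ⬝ᵥ (twoCutoffLine (isBlockUnion_fine hR') n a 1).mulVec V ≤ C * (V ⬝ᵥ (runA n L a R').mulVec V) := by
  classical
  have hL : 1 ≤ L := NeZero.one_le
  set N : Fin (d + 1) → ℕ := fun μ => n * M μ with hNdef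
  have hR'L : IsBlockUnion L R' := isBlockUnion_fine hR'
  have himg : R'.image (blk L) = boxDom N := by rw [hbox]; exact image_blk_fineBox M
  have hRF : R' = fineBox N L := by rw [hbox]; exact boxDom_eq_fineBox M
  set V' : (Fin (d + 1) → ℤ) → ℝ := fun Y => if h : Y ∈ R'.image (blk L) then V ⟨Y, h⟩ else 0 with hV'def
  have hV' : ∀ b : ↥(R'.image (blk L)), V' b.1 = V b := fun b => by rw [hV'def]; simp only [b.2, dite_true]
  set φ : ↥R' → ℝ := fun x' => lift N L V' x'.1 with hφdef
  have hφ : ∀ b, ∑ x' ∈ Finset.univ.filter (fun x' => rblk L R' x' = b), φ x' = (L : ℝ) ^ (d + 1) * V b := by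
    intro b
    rw [filter_rblk_eq_image hL hR'L b, Finset.sum_image fun j _ j' _ h => rchart_injective hL hR'L b h]
    have hb : b.1 ∈ boxDom N := by rw [← himg]; exact b.2
    rw [← hV' b, ← sum_lift_block hL V' hb]
    rfl
  have hfine : ∑ x' : ↥R', ∑ y' : ↥R', (if y'.1 ∈ nbrs x'.1 then (φ x' - φ y') ^ 2 else (0 : ℝ)) =
      2 * ∑ ν : Fin (d + 1), ∑ x ∈ (fineBox N L).filter (fun x => x + uvec ν ∈ fineBox N L),
        (lift N L V' (x + uvec ν) - lift N L V' x) ^ 2 := by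
    rw [← nbr_sq_sum_eq, ← hRF]
    rw [Finset.sum_coe_sort R' (fun x => ∑ y' : ↥R', (if y'.1 ∈ nbrs x then (lift N L V' x - φ y') ^ 2 else (0 : ℝ)))]
    exact Finset.sum_congr rfl fun x _ => Finset.sum_coe_sort R' (fun y => if y ∈ nbrs x then (lift N L V' x - lift N L V' y) ^ 2 else 0)
  have hcoarse : ∑ x : ↥(R'.image (blk L)), ∑ y : ↥(R'.image (blk L)), (if y.1 ∈ nbrs x.1 then (V x - V y) ^ 2 else (0 : ℝ)) =
      2 * ∑ ν : Fin (d + 1), ∑ Y ∈ (boxDom N).filter (fun Y => Y + uvec ν ∈ boxDom N), (V' Y - V' (Y + uvec ν)) ^ 2 := by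
    have h1 : ∑ x : ↥(R'.image (blk L)), ∑ y : ↥(R'.image (blk L)), (if y.1 ∈ nbrs x.1 then (V x - V y) ^ 2 else (0 : ℝ)) =
        ∑ x ∈ R'.image (blk L), ∑ y ∈ R'.image (blk L), (if y ∈ nbrs x then (V' x - V' y) ^ 2 else (0 : ℝ)) := by
      simp_rw [← hV']
      rw [Finset.sum_coe_sort (R'.image (blk L))
        (fun x => ∑ y : ↥(R'.image (blk L)), (if y.1 ∈ nbrs x then (V' x - V' y.1) ^ 2 else (0 : ℝ)))]
      exact Finset.sum_congr rfl fun x _ =>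
        Finset.sum_coe_sort (R'.image (blk L)) (fun y => if y ∈ nbrs x then (V' x - V' y) ^ 2 else 0)
    rw [h1, himg, nbr_sq_sum_eq]
    congr 1
    exact Finset.sum_congr rfl fun ν _ => Finset.sum_congr rfl fun Y _ => by ring
  have hdir : (L : ℝ) ^ 2 * ∑ x' : ↥R', ∑ y' : ↥R', (if y'.1 ∈ nbrs x'.1 then (φ x' - φ y') ^ 2 else (0 : ℝ)) ≤
      C * (L : ℝ) ^ (d + 1) * ∑ x : ↥(R'.image (blk L)), ∑ y : ↥(R'.image (blk L)),
        (if y.1 ∈ nbrs x.1 then (V x - V y) ^ 2 else (0 : ℝ)) := by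
    rw [hfine, hcoarse]
    calc (L : ℝ) ^ 2 * (2 * ∑ ν : Fin (d + 1), ∑ x ∈ (fineBox N L).filter (fun x => x + uvec ν ∈ fineBox N L),
          (lift N L V' (x + uvec ν) - lift N L V' x) ^ 2)
        = ∑ ν : Fin (d + 1), 2 * ((L : ℝ) ^ 2 * ∑ x ∈ (fineBox N L).filter (fun x => x + uvec ν ∈ fineBox N L),
          (lift N L V' (x + uvec ν) - lift N L V' x) ^ 2) := by
          rw [Finset.mul_sum, Finset.mul_sum]; exact Finset.sum_congr rfl fun ν _ => by ring
      _ ≤ ∑ ν : Fin (d + 1), 2 * (C * (L : ℝ) ^ (d + 1) *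
          ∑ Y ∈ (boxDom N).filter (fun Y => Y + uvec ν ∈ boxDom N), (V' Y - V' (Y + uvec ν)) ^ 2) :=
          Finset.sum_le_sum fun ν _ => mul_le_mul_of_nonneg_left (hE ν V') (by norm_num)
      _ = C * (L : ℝ) ^ (d + 1) * (2 * ∑ ν : Fin (d + 1),
          ∑ Y ∈ (boxDom N).filter (fun Y => Y + uvec ν ∈ boxDom N), (V' Y - V' (Y + uvec ν)) ^ 2) := by
          rw [Finset.mul_sum, Finset.mul_sum]; exact Finset.sum_congr rfl fun ν _ => by ring
  exact schurB_form_le_of_dirichlet hn hR' ha V φ hφ hC hdir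

/-- **THE ∂_s (LIPSCHITZ) LETTER FROM ANY UPPER TWO-RUN CONSTANT**: if `⟨v, P_B^{Schur}v⟩ ≤ C·⟨v, P_A v⟩` for every `v` (`C > 1`),
then for all `s, t ∈ [0,1]` and every `g`, `‖(G(s) − G(t))g‖² ≤ (t−s)²·((C − 1)∕min(2,a))²·‖g‖²` (lower constant ONE by
`NE7K1LinTwoRunJensen.runA_form_le_schurB_sharp`, coercivity `min(2,a)` by `lower18_zero`; the route of
`NE7K1LinHomGramUpper.twoCutoff_inv_lipschitz_gram`, made generic in `C`). [folklore] -/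
theorem twoCutoff_inv_lipschitz_of_le (hn : 1 ≤ n) {R' : Finset (Fin (d + 1) → ℤ)} (hR' : IsBlockUnion (n * L) R') {a : ℝ}
    (ha : 0 < a) {C : ℝ} (hC : 1 < C)
    (hup : ∀ v : ↥(R'.image (blk L)) → ℝ,
      v ⬝ᵥ (twoCutoffLine (isBlockUnion_fine hR') n a 1).mulVec v ≤ C * (v ⬝ᵥ (runA n L a R').mulVec v))
    {s t : ℝ} (hs0 : 0 ≤ s) (hs1 : s ≤ 1) (ht0 : 0 ≤ t) (ht1 : t ≤ 1) (g : ↥(R'.image (blk L)) → ℝ) :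
    ((twoCutoffLine (isBlockUnion_fine hR') n a s)⁻¹ - (twoCutoffLine (isBlockUnion_fine hR') n a t)⁻¹).mulVec g ⬝ᵥ
        ((twoCutoffLine (isBlockUnion_fine hR') n a s)⁻¹ - (twoCutoffLine (isBlockUnion_fine hR') n a t)⁻¹).mulVec g ≤
      (t - s) ^ 2 * ((C - 1) / min 2 a) ^ 2 * (g ⬝ᵥ g) := by
  have hL : 1 ≤ L := NeZero.one_le
  have hR'L : IsBlockUnion L R' := isBlockUnion_fine hR'
  have hRc : IsBlockUnion n (R'.image (blk L)) := isBlockUnion_coarse hL hR'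
  have hmin : 0 < min 2 a := lt_min (by norm_num) ha
  set H := runB hR'L n a with hH
  have hP₀ : ∀ v, min 2 a * (v ⬝ᵥ v) ≤ v ⬝ᵥ (runA n L a R').mulVec v := fun v => lower18_zero hn ha.le hRc v
  have hP₀nn : ∀ v, 0 ≤ v ⬝ᵥ (runA n L a R').mulVec v := fun v =>
    le_trans (mul_nonneg hmin.le ((Finset.sum_nonneg fun i _ => mul_self_nonneg (v i)))) (hP₀ v)
  have hlow' : ∀ v, 1 * (v ⬝ᵥ (runA n L a R').mulVec v) ≤ v ⬝ᵥ (twoCutoffLine hR'L n a 1).mulVec v := fun v => by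
    rw [one_mul]; exact runA_form_le_schurB_sharp hn hR' ha v
  have hup' : ∀ v, v ⬝ᵥ (twoCutoffLine hR'L n a 1).mulVec v ≤ C * (v ⬝ᵥ (runA n L a R').mulVec v) := hup
  simp only [twoCutoffLine_one] at hlow' hup'
  have hKpos : (0 : ℝ) < C - 1 := by linarith
  have hP₁ : ∀ v, min 2 a * (v ⬝ᵥ v) ≤
      v ⬝ᵥ (H.toBlocks₁₁ - H.toBlocks₁₂ * (H.toBlocks₂₂)⁻¹ * H.toBlocks₂₁).mulVec v := by
    intro v
    have h1 := hlow' v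
    rw [one_mul] at h1
    exact (hP₀ v).trans h1
  have hup'' : ∀ v, v ⬝ᵥ (H.toBlocks₁₁ - H.toBlocks₁₂ * (H.toBlocks₂₂)⁻¹ * H.toBlocks₂₁).mulVec v -
      v ⬝ᵥ (runA n L a R').mulVec v ≤ (C - 1) * (v ⬝ᵥ (runA n L a R').mulVec v) := by
    intro v
    have h1 := hup' v
    linarith
  have hlo : ∀ v, v ⬝ᵥ (runA n L a R').mulVec v -
      v ⬝ᵥ (H.toBlocks₁₁ - H.toBlocks₁₂ * (H.toBlocks₂₂)⁻¹ * H.toBlocks₂₁).mulVec v ≤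
      (C - 1) * (v ⬝ᵥ (runA n L a R').mulVec v) := by
    intro v
    have h1 := hlow' v; have h2 := hP₀nn v
    rw [one_mul] at h1
    nlinarith [mul_nonneg hKpos.le h2]
  have main := lineOpR_inv_sub_inv_rel (runA n L a R') H.toBlocks₁₁ H.toBlocks₁₂ H.toBlocks₂₁ H.toBlocks₂₂
    (fineOpR_isSymm n a 0 _) (schurB_isSymm hR'L n a) hmin one_pos le_rfl hKpos hP₀ hP₁ hlow' hup'' hlo hs0 hs1 ht0 ht1 g
  rw [one_mul] at main
  exact main

end Generic

/-! ### §4 The upper two-run comparison with the spectral constant `3·(6∕5)^d`, and its ∂_s letter -/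

section Assembly

open NE7K1LinSchurLineU1 NE7K1LinSchurLineForm NE7K1LinBlockCoords NE7K1LinTwoRunKit

variable {n L : ℕ} [NeZero L]

/-- **THE L-UNIFORM UPPER TWO-RUN COMPARISON ON BOXES WITH THE SPECTRAL CONSTANT**: `⟨V,P_B^{Schur}V⟩ ≤ 3·(6∕5)^d·⟨V,P_A V⟩` for
`a > 0`, `n ≥ 1`, `L ≥ 1`, `R′ = Π_μ[0, nLM_μ)` (= 3, 3.6, 4.32, 5.184 for `d + 1 = 1…4`; `NE7K1LinHomGramUpper.schurB_form_le_gram`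
had `3·(37∕30)^d` = 3, 3.70, 4.56, 5.63; lens 2's sharp floors 3, 3.5568, 4.1319, 4.7207). [folklore] -/
theorem schurB_form_le_spec (hn : 1 ≤ n) (M : Fin (d + 1) → ℕ) {R' : Finset (Fin (d + 1) → ℤ)}
    (hbox : R' = boxDom fun μ => n * L * M μ) (hR' : IsBlockUnion (n * L) R') {a : ℝ} (ha : 0 < a)
    (V : ↥(R'.image (blk L)) → ℝ) :
    V ⬝ᵥ (twoCutoffLine (isBlockUnion_fine hR') n a 1).mulVec V ≤ 3 * (6 / 5 : ℝ) ^ d * (V ⬝ᵥ (runA n L a R').mulVec V) := by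
  have hL : 1 ≤ L := NeZero.one_le
  have hC : (1 : ℝ) ≤ 3 * (6 / 5 : ℝ) ^ d := by
    have : (1 : ℝ) ≤ (6 / 5 : ℝ) ^ d := one_le_pow₀ (by norm_num)
    linarith
  exact schurB_form_le_of_energy hn M hbox hR' ha hC (fun ν V' => energy_dir_le_spec hL ν V') V

/-- **THE ∂_s (LIPSCHITZ) LETTER WITH THE SPECTRAL CONSTANT**: on boxes, for all `s, t ∈ [0,1]`, every `g` and every `L`,
`‖(G(s) − G(t))g‖² ≤ (t−s)²·((3·(6∕5)^d − 1)∕min(2,a))²·‖g‖²`. [folklore] -/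
theorem twoCutoff_inv_lipschitz_spec (hn : 1 ≤ n) (M : Fin (d + 1) → ℕ) {R' : Finset (Fin (d + 1) → ℤ)}
    (hbox : R' = boxDom fun μ => n * L * M μ) (hR' : IsBlockUnion (n * L) R') {a : ℝ} (ha : 0 < a)
    {s t : ℝ} (hs0 : 0 ≤ s) (hs1 : s ≤ 1) (ht0 : 0 ≤ t) (ht1 : t ≤ 1) (g : ↥(R'.image (blk L)) → ℝ) :
    ((twoCutoffLine (isBlockUnion_fine hR') n a s)⁻¹ - (twoCutoffLine (isBlockUnion_fine hR') n a t)⁻¹).mulVec g ⬝ᵥ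
        ((twoCutoffLine (isBlockUnion_fine hR') n a s)⁻¹ - (twoCutoffLine (isBlockUnion_fine hR') n a t)⁻¹).mulVec g ≤
      (t - s) ^ 2 * ((3 * (6 / 5 : ℝ) ^ d - 1) / min 2 a) ^ 2 * (g ⬝ᵥ g) := by
  have hC : (1 : ℝ) < 3 * (6 / 5 : ℝ) ^ d := by
    have : (1 : ℝ) ≤ (6 / 5 : ℝ) ^ d := one_le_pow₀ (by norm_num)
    linarith
  exact twoCutoff_inv_lipschitz_of_le hn hR' ha hC (fun v => schurB_form_le_spec hn M hbox hR' ha v) hs0 hs1 ht0 ht1 g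

end Assembly

end Summit.QuantumFields.BalabanUV.T4Continuum.NE7K1LinHomSpecUpper
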